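import Mathlib
import Literature.Computability.AlgebraicComplexity.OdlyzkoHypercubeSubspaceProofs
import Summits.ValiantsHypothesis.ValiantsHypothesis.Theses.FreeSubtorus
import Summits.ValiantsHypothesis.ValiantsHypothesis.Theorems.FreeSubtorusConfusionCovering

/-!
# The DIAL of the rung `ConfusionCovering`: class count `≤ 2^r` (Odlyzko), hence rung ⇒ floor, in tree vocabulary

Crux dir `OrbitDimensionBound` (stmt-ValiantsHypothesis-16133, route FreeSubtorus), ladder `Lines/ConfusionLadder.lean`:
the rung `ConfusionCovering` (`C(n,⌊n/2⌋) ≤ m · κ_{⌊n/2⌋}(Λ)`, PROVED in class form as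
`Theorems.FreeSubtorusConfusionCovering.confusionCovering`, p177872) sits over the proved floor
`Theses.FreeSubtorus.SubtorusCovering` (`C(n,⌊n/2⌋) ≤ m · 2^r`, `Theorems.FreeSubtorusSubtorusCovering.subtorusCovering_proof`)
along the loss dial `κ ≤ 2^r`.  This file lands the dial in TREE vocabulary (the Cruxes-local `classCount` / `confusion`
unfolded, exactly the expression of `confusionCovering`):

* `card_confusedClass_le_two_pow` — for any lattice data `Λ : Fin r → ([n] ⊔ [n]) → ℤ`, level `d` and pair `q = (S, T)`,
  the number of level-`d` pairs `p` whose indicator character `(1_{p.1} ; 1_{p.2}) ∈ {0,1}^{[n] ⊔ [n]}` is congruent to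
  that of `q` modulo `span_ℚ {Λ_i}` is at most `2^r`.  Proof: `p ↦ (1_{p.1} ; 1_{p.2})` is injective into the hypercube
  points of the translate `(1_S ; 1_T) + span_ℚ Λ`, which holds `≤ 2^{dim span_ℚ Λ} ≤ 2^r` of them — Odlyzko's lemma, tree
  theorem `Literature.Computability.AlgebraicComplexity.ncard_hypercube_inter_translate_le`. [cite: Odlyzko1988, p. 127]
* `choose_le_mul_two_pow_of_confusedClass` — the dial POINTWISE: the rung's conclusion (`C(n,⌊n/2⌋) ≤ m · #class(q)` for
  some middle-level pair `q`) implies the floor's (`C(n,⌊n/2⌋) ≤ m · 2^r`); the closing `example` composes it with the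
  class-form rung `confusionCovering` into a second proof of the floor `SubtorusCovering` THROUGH the rung — the F3
  triangle rung ⇒ floor, closed in the tree. [cite: LandsbergRessayre2017, Thm. 2.8, §6]
-/

open Finset Module

-- the mandated summit-side namespace repeats a component by design (single-problem summit)
set_option linter.dupNamespace false

namespace Summit.ValiantsHypothesis.ValiantsHypothesis.Theorems.FreeSubtorusConfusionCovering

open Classical in
/-- **Odlyzko bound for a confusion class.**  For lattice data `Λ : Fin r → (Fin n ⊕ Fin n) → ℤ`, a level `d` and a pair
`q`, the level-`d` pairs `p = (p.1, p.2)` whose indicator character is congruent to that of `q` modulo `span_ℚ {Λ_i}` number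
at most `2^r` (indicator characters are hypercube points, and a translate of a subspace of dimension `≤ r` holds at most `2^r`
of them). [cite: Odlyzko1988, p. 127] -/
theorem card_confusedClass_le_two_pow (n r d : ℕ) (Λ : Fin r → (Fin n ⊕ Fin n) → ℤ)
    (q : Finset (Fin n) × Finset (Fin n)) :
    (univ.filter fun p : Finset (Fin n) × Finset (Fin n) =>
        p.1.card = d ∧ p.2.card = d ∧
        ∃ c : Fin r → ℚ, ∀ x : Fin n ⊕ Fin n,
          ((Sum.elim (fun k => if k ∈ p.1 then (1 : ℤ) else 0) (fun l => if l ∈ p.2 then (1 : ℤ) else 0) x : ℤ) : ℚ) -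
          ((Sum.elim (fun k => if k ∈ q.1 then (1 : ℤ) else 0) (fun l => if l ∈ q.2 then (1 : ℤ) else 0) x : ℤ) : ℚ)
            = ∑ i, c i * ((Λ i x : ℤ) : ℚ)).card ≤ 2 ^ r := by
  classical
  -- the indicator character of a pair, as a rational vector
  set χ : Finset (Fin n) × Finset (Fin n) → (Fin n ⊕ Fin n) → ℚ := fun p x =>
    ((Sum.elim (fun k => if k ∈ p.1 then (1 : ℤ) else 0) (fun l => if l ∈ p.2 then (1 : ℤ) else 0) x : ℤ) : ℚ) with hχ
  -- the rational span of the generators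
  set Λq : Fin r → (Fin n ⊕ Fin n) → ℚ := fun i x => ((Λ i x : ℤ) : ℚ) with hΛq
  set V : Submodule ℚ ((Fin n ⊕ Fin n) → ℚ) := Submodule.span ℚ (Set.range Λq) with hV
  -- indicator characters are hypercube points
  have h01 : ∀ p x, χ p x = 0 ∨ χ p x = 1 := by
    intro p x
    rcases x with k | l
    · by_cases hk : k ∈ p.1 <;> simp [hχ, hk]
    · by_cases hl : l ∈ p.2 <;> simp [hχ, hl]
  -- and determine the pair
  have hinj : Function.Injective χ := by
    intro p p' h
    have h1 : ∀ x, χ p x = χ p' x := fun x => congrFun h x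
    refine Prod.ext (Finset.ext fun k => ?_) (Finset.ext fun l => ?_)
    · have hk := h1 (Sum.inl k)
      by_cases ha : k ∈ p.1 <;> by_cases hb : k ∈ p'.1 <;> simp [hχ, ha, hb] at hk ⊢
    · have hl := h1 (Sum.inr l)
      by_cases ha : l ∈ p.2 <;> by_cases hb : l ∈ p'.2 <;> simp [hχ, ha, hb] at hl ⊢
  -- the hypercube points of the translate `χ q + V` form a finite set
  have hfin : {x : (Fin n ⊕ Fin n) → ℚ | (∀ i, x i = 0 ∨ x i = 1) ∧ x - χ q ∈ V}.Finite := by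
    refine Set.Finite.subset (Set.Finite.pi fun _ : Fin n ⊕ Fin n => Set.toFinite ({0, 1} : Set ℚ)) ?_
    intro x hx
    simp only [Set.mem_univ_pi, Set.mem_insert_iff, Set.mem_singleton_iff]
    exact fun i => hx.1 i
  -- the class maps into it
  have hmaps : ∀ p ∈ (↑(univ.filter fun p : Finset (Fin n) × Finset (Fin n) =>
        p.1.card = d ∧ p.2.card = d ∧
        ∃ c : Fin r → ℚ, ∀ x : Fin n ⊕ Fin n, χ p x - χ q x = ∑ i, c i * Λq i x) : Set _),
      χ p ∈ {x : (Fin n ⊕ Fin n) → ℚ | (∀ i, x i = 0 ∨ x i = 1) ∧ x - χ q ∈ V} := by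
    intro p hp
    simp only [coe_filter, mem_univ, true_and, Set.mem_setOf_eq] at hp
    obtain ⟨-, -, c, hc⟩ := hp
    refine ⟨h01 p, ?_⟩
    rw [hV, Submodule.mem_span_range_iff_exists_fun]
    refine ⟨c, ?_⟩
    funext x
    simp only [Finset.sum_apply, Pi.smul_apply, smul_eq_mul, Pi.sub_apply]
    exact (hc x).symm
  calc (univ.filter fun p : Finset (Fin n) × Finset (Fin n) =>
          p.1.card = d ∧ p.2.card = d ∧
          ∃ c : Fin r → ℚ, ∀ x : Fin n ⊕ Fin n, χ p x - χ q x = ∑ i, c i * Λq i x).card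
      = (↑(univ.filter fun p : Finset (Fin n) × Finset (Fin n) =>
          p.1.card = d ∧ p.2.card = d ∧
          ∃ c : Fin r → ℚ, ∀ x : Fin n ⊕ Fin n, χ p x - χ q x = ∑ i, c i * Λq i x) : Set _).ncard :=
        (Set.ncard_coe_finset _).symm
    _ ≤ {x : (Fin n ⊕ Fin n) → ℚ | (∀ i, x i = 0 ∨ x i = 1) ∧ x - χ q ∈ V}.ncard :=
        Set.ncard_le_ncard_of_injOn χ hmaps (hinj.injOn) hfin
    _ ≤ 2 ^ finrank ℚ V :=
        Literature.Computability.AlgebraicComplexity.ncard_hypercube_inter_translate_le ℚ V (χ q)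
    _ ≤ 2 ^ r := by
        refine Nat.pow_le_pow_right (by norm_num) ?_
        rw [hV]
        have h := finrank_range_le_card (R := ℚ) Λq
        rw [Fintype.card_fin] at h
        exact h

open Classical in
/-- **The dial, pointwise: the rung's conclusion implies the floor's.**  If some level-`⌊n/2⌋` pair `q` has
`C(n,⌊n/2⌋) ≤ m · #class(q)` (the conclusion of the class-form rung `confusionCovering`), then `C(n,⌊n/2⌋) ≤ m · 2^r`
(the conclusion of the floor `SubtorusCovering`) — by `card_confusedClass_le_two_pow`.  No hypothesis on the
representation is involved: this is the loss dial `κ_{⌊n/2⌋}(Λ) ≤ 2^r` of the ladder, in tree vocabulary.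
[cite: Odlyzko1988, p. 127] [cite: LandsbergRessayre2017, §6] -/
theorem choose_le_mul_two_pow_of_confusedClass (n m r : ℕ) (Λ : Fin r → (Fin n ⊕ Fin n) → ℤ)
    (h : ∃ q : Finset (Fin n) × Finset (Fin n), q.1.card = n / 2 ∧ q.2.card = n / 2 ∧
      n.choose (n / 2) ≤ m * (univ.filter fun p : Finset (Fin n) × Finset (Fin n) =>
        p.1.card = n / 2 ∧ p.2.card = n / 2 ∧
        ∃ c : Fin r → ℚ, ∀ x : Fin n ⊕ Fin n,
          ((Sum.elim (fun k => if k ∈ p.1 then (1 : ℤ) else 0) (fun l => if l ∈ p.2 then (1 : ℤ) else 0) x : ℤ) : ℚ) -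
          ((Sum.elim (fun k => if k ∈ q.1 then (1 : ℤ) else 0) (fun l => if l ∈ q.2 then (1 : ℤ) else 0) x : ℤ) : ℚ)
            = ∑ i, c i * ((Λ i x : ℤ) : ℚ)).card) :
    n.choose (n / 2) ≤ m * 2 ^ r := by
  obtain ⟨q, -, -, hle⟩ := h
  exact hle.trans (Nat.mul_le_mul_left m (card_confusedClass_le_two_pow n r (n / 2) Λ q))

/-- **The F3 triangle, in the tree: rung ⇒ floor.**  The class-form rung `confusionCovering` composed with the dial
`choose_le_mul_two_pow_of_confusedClass` re-proves the floor `Theses.FreeSubtorus.SubtorusCovering` through the rung (an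
`example`, since the floor is already the landed theorem `Theorems.FreeSubtorusSubtorusCovering.subtorusCovering_proof`).
[cite: LandsbergRessayre2017, Thm. 2.8, §6] -/
example : Summit.ValiantsHypothesis.ValiantsHypothesis.Theses.FreeSubtorus.SubtorusCovering :=
  fun n hn m r Λ B hΛ hB =>
    choose_le_mul_two_pow_of_confusedClass n m r Λ (confusionCovering n hn m r Λ B hΛ hB)

end Summit.ValiantsHypothesis.ValiantsHypothesis.Theorems.FreeSubtorusConfusionCovering
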